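import Mathlib.Algebra.CharP.Lemmas
import Mathlib.Algebra.CharP.Algebra
import Summits.QuantumAdvantage.QuantumAdvantage.Theorems.SymplecticPurityNoFreeFrameCyclo
import Summits.QuantumAdvantage.QuantumAdvantage.Theorems.SymplecticPurityNoFreeFrameFamily

/-!
# Route `SymplecticPurity`, item `NoFreeFrame` — the cube program computes `y ↦ y³`

For the good input lengths `n = 2·3^k` the Boolean map `cubeMap n` of the witness program is the
cube map of the field `K = 𝔽₂[X]/(Φ_{3^{k+1}})` read in the power-basis coordinates
`e = cubeEquiv k`:

  `cubeMap n y = (l ↦ [e((e⁻¹ y)³)_l = 1])`   (`cubeMap_eq_cube`).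

Steps: in `K`, `α^{3h} = 1` and `α^{2h} = α^h + 1` (`h = 3^k`, `α` the class of `X`), whence
`α^m = Σ_{l ∈ cubeExps h m} α^l` (`root_pow_eq_sum`) and the coordinates of `α^m` are the parities of
`cubeExps h m` (`cubeEquiv_root_pow`); `(Σ cᵢ αⁱ)³ = Σ_{i,j} cᵢ cⱼ α^{i+2j}` by Frobenius; and the program
side is an XOR network whose targets are ancillas and whose controls are inputs (`clEval_xor`), so
bit `l` is the parity `Σ_i cᵢ [l ∈ E(3i)] + Σ_{i≠j} cᵢ cⱼ [l ∈ E(i+2j)]` — the same double sum with its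
diagonal separated.
-/

noncomputable section

set_option linter.dupNamespace false -- D-0017: single-problem summit ⇒ `QuantumAdvantage.QuantumAdvantage` by design

namespace Summit.QuantumAdvantage.QuantumAdvantage.Theorems.SymplecticPurity

open Polynomial
open Literature.Computability.QuantumComplexity Literature.Computability.Cryptography

section Field

variable (k : ℕ)

local notation "𝕂" => AdjoinRoot (cubePoly k)
local notation "α" => AdjoinRoot.root (cubePoly k)

/-! ### Arithmetic in `𝔽₂[X]/(Φ_{3^{k+1}})` -/

/-- `K` is nontrivial. -/
theorem nontrivial_cubeField : Nontrivial 𝕂 :=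
  AdjoinRoot.nontrivial _ (by
    rw [Polynomial.degree_cyclotomic]
    exact_mod_cast (Nat.totient_pos.2 (pow_pos (by norm_num) _)).ne')

/-- `2 = 0` in `K`. -/
theorem two_eq_zero : (2 : 𝕂) = 0 := by
  rw [show (2 : 𝕂) = algebraMap (ZMod 2) 𝕂 2 from (map_ofNat _ 2).symm,
    show (2 : ZMod 2) = 0 from rfl, map_zero]

/-- `x + x = 0` in `K`. -/
theorem add_self_eq_zero (x : 𝕂) : x + x = 0 := by rw [← two_mul, two_eq_zero, zero_mul]

/-- `K` has exponential characteristic `2` (Frobenius is additive). -/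
theorem expChar_cubeField : ExpChar 𝕂 2 := by
  haveI := nontrivial_cubeField k
  haveI : ExpChar (ZMod 2) 2 := ExpChar.prime Nat.prime_two
  exact expChar_of_injective_algebraMap (algebraMap (ZMod 2) 𝕂).injective 2

/-- The defining relation: `α^{2·3^k} = α^{3^k} + 1`. -/
theorem root_pow_two_mul : (α) ^ (2 * 3 ^ k) = (α) ^ 3 ^ k + 1 := by
  have h : aeval (α) (X ^ (2 * 3 ^ k) + X ^ 3 ^ k + 1 : (ZMod 2)[X]) = 0 := by
    rw [← cubePoly_eq, AdjoinRoot.aeval_eq, AdjoinRoot.mk_self]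
  simp only [map_add, map_pow, aeval_X, map_one] at h
  rw [add_assoc] at h
  have h2 := eq_neg_of_add_eq_zero_left h
  rw [h2, neg_eq_iff_add_eq_zero, add_self_eq_zero]

/-- `α^{3^{k+1}} = 1` (`Φ_{3^{k+1}} ∣ X^{3^{k+1}} − 1`). -/
theorem root_pow_three_mul : (α) ^ (3 * 3 ^ k) = 1 := by
  have hd : cubePoly k ∣ X ^ (3 ^ (k + 1)) - 1 := Polynomial.cyclotomic.dvd_X_pow_sub_one _ _
  have h : aeval (α) (X ^ (3 ^ (k + 1)) - 1 : (ZMod 2)[X]) = 0 := by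
    rw [AdjoinRoot.aeval_eq, AdjoinRoot.mk_eq_zero.2 hd]
  simp only [map_sub, map_pow, aeval_X, map_one, sub_eq_zero] at h
  rw [← h, pow_succ]
  ring_nf

/-- Exponents of `α` only matter modulo `3·3^k`. -/
theorem root_pow_mod (m : ℕ) : (α) ^ m = (α) ^ (m % (3 * 3 ^ k)) := by
  conv_lhs => rw [← Nat.mod_add_div m (3 * 3 ^ k), pow_add, pow_mul, root_pow_three_mul, one_pow,
    mul_one]

/-- **`α^m` is the sum of the powers listed by `cubeExps 3^k m`.** -/
theorem root_pow_eq_sum (m : ℕ) : (α) ^ m = ((cubeExps (3 ^ k) m).map fun l => (α) ^ l).sum := by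
  have hh : (3 ^ k : ℕ) ≠ 0 := pow_ne_zero _ (by norm_num)
  rw [root_pow_mod, cubeExps, if_neg hh]
  set r := m % (3 * 3 ^ k) with hr
  by_cases hlt : r < 2 * 3 ^ k
  · rw [if_pos hlt]; simp
  · rw [if_neg hlt]
    simp only [List.map_cons, List.map_nil, List.sum_cons, List.sum_nil, add_zero]
    have hr2 : 2 * 3 ^ k ≤ r := Nat.le_of_not_lt hlt
    conv_lhs => rw [show r = (r - 2 * 3 ^ k) + 2 * 3 ^ k by omega, pow_add, root_pow_two_mul, mul_add,
      mul_one, ← pow_add, show r - 2 * 3 ^ k + 3 ^ k = r - 3 ^ k by omega]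

/-! ### Coordinates -/

/-- The power basis consists of the powers of `α`. -/
theorem cubeBasis_apply (i : Fin (2 * 3 ^ k)) : cubeBasis k i = (α) ^ (i : ℕ) := by
  simp [cubeBasis, Module.Basis.reindex_apply, PowerBasis.coe_basis, AdjoinRoot.powerBasis'_gen]

/-- `cubeEquiv` is the coordinate map of `cubeBasis` (as a linear equivalence). -/
theorem cubeEquiv_apply (z : 𝕂) : cubeEquiv k z = (cubeBasis k).equivFun z := rfl

/-- The coordinates of a power of `α` below the degree. -/
theorem cubeEquiv_root_pow_of_lt {l' : ℕ} (hl' : l' < 2 * 3 ^ k) (l : Fin (2 * 3 ^ k)) :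
    cubeEquiv k ((α) ^ l') l = if l' = (l : ℕ) then 1 else 0 := by
  rw [show (α) ^ l' = cubeBasis k ⟨l', hl'⟩ from (cubeBasis_apply k ⟨l', hl'⟩).symm, cubeEquiv_apply,
    Module.Basis.equivFun_self]
  simp only [Fin.ext_iff]

/-- Evaluating a list sum of coordinate vectors. -/
theorem list_sum_apply {n : ℕ} (L : List (Fin n → ZMod 2)) (l : Fin n) :
    L.sum l = (L.map fun f => f l).sum := by
  induction L with
  | nil => rfl
  | cons f L ih => rw [List.sum_cons, List.map_cons, List.sum_cons, Pi.add_apply, ih]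

/-- **The coordinates of `α^m` are the parities of `cubeExps 3^k m`.** -/
theorem cubeEquiv_root_pow (m : ℕ) (l : Fin (2 * 3 ^ k)) :
    cubeEquiv k ((α) ^ m) l =
      ((cubeExps (3 ^ k) m).map fun l' => if l' = (l : ℕ) then (1 : ZMod 2) else 0).sum := by
  rw [root_pow_eq_sum, map_list_sum, list_sum_apply, List.map_map, List.map_map]
  congr 1
  refine List.map_congr_left fun l' hl' => ?_
  exact cubeEquiv_root_pow_of_lt k (lt_of_mem_cubeExps hl') l

/-- The inverse coordinate map: `e⁻¹ c = Σ cᵢ αⁱ`. -/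
theorem cubeEquiv_symm_apply (c : Fin (2 * 3 ^ k) → ZMod 2) :
    (cubeEquiv k).symm c = ∑ i, c i • (α) ^ (i : ℕ) := by
  rw [show (cubeEquiv k).symm c = (cubeBasis k).equivFun.symm c from rfl,
    Module.Basis.equivFun_symm_apply]
  simp only [cubeBasis_apply]

/-- **The cube of `Σ cᵢ αⁱ` is `Σ_{i,j} cᵢ cⱼ α^{i+2j}`** (Frobenius in characteristic `2`). -/
theorem cube_expand (c : Fin (2 * 3 ^ k) → ZMod 2) :
    ((cubeEquiv k).symm c) ^ 3 = ∑ i, ∑ j, (c i * c j) • (α) ^ ((i : ℕ) + 2 * (j : ℕ)) := by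
  haveI := expChar_cubeField k
  rw [cubeEquiv_symm_apply, pow_succ', sum_pow_char 2, Finset.sum_mul_sum]
  refine Finset.sum_congr rfl fun i _ => Finset.sum_congr rfl fun j _ => ?_
  rw [_root_.smul_pow, ZMod.pow_card, ← pow_mul, smul_mul_smul_comm, ← pow_add, mul_comm (j : ℕ) 2]

/-- **Coordinates of the cube**: `e((e⁻¹c)³)_l = Σ_{i,j} cᵢ cⱼ · e(α^{i+2j})_l`. -/
theorem cubeEquiv_cube (c : Fin (2 * 3 ^ k) → ZMod 2) (l : Fin (2 * 3 ^ k)) :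
    cubeEquiv k (((cubeEquiv k).symm c) ^ 3) l =
      ∑ i : Fin (2 * 3 ^ k), ∑ j : Fin (2 * 3 ^ k),
        c i * c j * cubeEquiv k ((α) ^ ((i : ℕ) + 2 * (j : ℕ))) l := by
  rw [cube_expand, cubeEquiv_apply, map_sum, Finset.sum_apply]
  refine Finset.sum_congr rfl fun i _ => ?_
  rw [map_sum, Finset.sum_apply]
  refine Finset.sum_congr rfl fun j _ => ?_
  rw [map_smul, Pi.smul_apply, smul_eq_mul, cubeEquiv_apply]

end Field

/-! ### The program side: an XOR network -/

/-- **XOR networks.** If every control of `ops` is an input wire (`< n`) and every target an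
ancilla wire (`≥ n`), then wire `i` ends as its initial value XOR the parity of the guards (read on
any assignment agreeing with the initial one on the inputs) of the gates targeting `i`. -/
theorem clEval_xor (n : ℕ) : ∀ (ops : List (ClOp ℕ)), (∀ op ∈ ops, ∀ c ∈ op.controls, c < n) →
    (∀ op ∈ ops, n ≤ op.target) → ∀ (w w' : ℕ → Bool), (∀ c, c < n → w c = w' c) → ∀ (i : ℕ),
    clEval ops w i =
      (w i ^^ ops.foldr (fun op acc => (decide (op.target = i) && op.guard w') ^^ acc) false)
  | [], _, _, w, w', _, i => by simp
  | op :: ops, hc, ht, w, w', hww, i => by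
    have hc' : ∀ o ∈ ops, ∀ c ∈ o.controls, c < n := fun o ho => hc o (List.mem_cons_of_mem _ ho)
    have ht' : ∀ o ∈ ops, n ≤ o.target := fun o ho => ht o (List.mem_cons_of_mem _ ho)
    have hagree : ∀ c, c < n → op.eval w c = w' c := fun c hcn => by
      rw [ClOp.eval_apply_of_ne _ _ (fun h => ?_), hww c hcn]
      have := ht op List.mem_cons_self; omega
    rw [clEval_cons, clEval_xor n ops hc' ht' (op.eval w) w' hagree i, List.foldr_cons, ClOp.eval_apply,
      ClOp.guard_congr op (fun c hcc => hww c (hc op List.mem_cons_self c hcc)), Bool.xor_assoc]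

/-- Controls of the cube program are input wires. -/
theorem controls_lt_of_mem_cubeOpsA {n : ℕ} {op : ClOp ℕ} (hop : op ∈ cubeOpsA n) :
    ∀ c ∈ op.controls, c < n := by
  simp only [cubeOpsA, cubeLinOps, cubeQuadOps, List.mem_append, List.mem_flatMap, List.mem_map,
    List.mem_range] at hop
  rcases hop with ⟨a, ha, l, -, rfl⟩ | ⟨a, ha, b, hb, hop⟩
  · simp [ClOp.controls, ha]
  · split_ifs at hop
    · simp at hop
    · rw [List.mem_map] at hop
      obtain ⟨l, -, rfl⟩ := hop
      simp [ClOp.controls, ha, hb]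

/-- Booleans as elements of `𝔽₂`: XOR-parity is the sum. -/
theorem ite_foldr_xor (L : List Bool) :
    (if L.foldr xor false then (1 : ZMod 2) else 0) = (L.map fun b => if b then (1 : ZMod 2) else 0).sum := by
  induction L with
  | nil => simp
  | cons b L ih =>
    rw [List.foldr_cons, List.map_cons, List.sum_cons, ← ih]
    generalize List.foldr xor false L = F
    cases b <;> cases F <;> decide

/-- Booleans as elements of `𝔽₂`: `&&` is the product. -/
theorem ite_and (a b : Bool) :
    (if (a && b) then (1 : ZMod 2) else 0) = (if a then (1 : ZMod 2) else 0) * (if b then 1 else 0) := by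
  cases a <;> cases b <;> simp

/-- List sums over `range n` are `Finset.range` sums. -/
theorem sum_map_range {M : Type*} [AddCommMonoid M] (f : ℕ → M) (n : ℕ) :
    ((List.range n).map f).sum = ∑ i ∈ Finset.range n, f i := by
  induction n with
  | zero => simp
  | succ n ih => rw [List.sum_range_succ, Finset.sum_range_succ, ih]

/-- Sum of a `flatMap` is the sum of the sums. -/
theorem sum_flatMap {α M : Type*} [AddMonoid M] (l : List α) (f : α → List M) :
    (l.flatMap f).sum = (l.map fun a => (f a).sum).sum := by
  induction l with
  | nil => simp
  | cons a l ih => rw [List.flatMap_cons, List.sum_append, List.map_cons, List.sum_cons, ih]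

/-! ### The main identification -/

section Main

variable (k : ℕ)

local notation "α" => AdjoinRoot.root (cubePoly k)
local notation "ν" => (2 * 3 ^ k)

/-- The parity, over the cube program, of the guards of the gates hitting ancilla `n + l`, as an
element of `𝔽₂`: `Σ_i c_i C(3i) + Σ_i Σ_{j ≠ i} c_i c_j C(i + 2j)` with `c_i = [w i]` and
`C(m) = e(α^m)_l`. -/
theorem cubeOpsA_parity (w : ℕ → Bool) (l : Fin ν) :
    (((cubeOpsA ν).map fun op =>
        if (decide (op.target = ν + (l : ℕ)) && op.guard w) then (1 : ZMod 2) else 0).sum) =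
      (∑ i ∈ Finset.range ν,
          (if w i then (1 : ZMod 2) else 0) * cubeEquiv k ((α) ^ (3 * i)) l) +
      ∑ i ∈ Finset.range ν, ∑ j ∈ Finset.range ν,
        if i = j then 0 else
          (if w i then (1 : ZMod 2) else 0) * (if w j then 1 else 0) * cubeEquiv k ((α) ^ (i + 2 * j)) l := by
  have hdiv : ν / 2 = 3 ^ k := by omega
  -- one chunk of gates onto the ancilla register, all with the same guard value `g`
  have hchunk : ∀ (m : ℕ) (g : ZMod 2) (mk : ℕ → ClOp ℕ),
      (∀ l', (mk l').target = ν + l') → (∀ l', (if (mk l').guard w then (1 : ZMod 2) else 0) = g) →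
      (((cubeExps (3 ^ k) m).map mk).map fun op =>
          if (decide (op.target = ν + (l : ℕ)) && op.guard w) then (1 : ZMod 2) else 0).sum =
        g * cubeEquiv k ((α) ^ m) l := by
    intro m g mk htgt hguard
    rw [cubeEquiv_root_pow, List.map_map, mul_comm g, ← List.sum_map_mul_right]
    congr 1
    refine List.map_congr_left fun l' _ => ?_
    rw [Function.comp_apply, ite_and, hguard, htgt]
    congr 1
    simp [eq_comm]
  rw [cubeOpsA, List.map_append, List.sum_append]
  congr 1
  · -- the linear part
    rw [cubeLinOps, List.map_flatMap, sum_flatMap, sum_map_range, hdiv]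
    refine Finset.sum_congr rfl fun i _ => ?_
    exact hchunk (3 * i) _ (fun l' => ClOp.cnot i (ν + l')) (fun _ => rfl) (fun _ => rfl)
  · -- the quadratic part
    rw [cubeQuadOps, List.map_flatMap, sum_flatMap, sum_map_range, hdiv]
    refine Finset.sum_congr rfl fun i _ => ?_
    rw [List.map_flatMap, sum_flatMap, sum_map_range]
    refine Finset.sum_congr rfl fun j _ => ?_
    by_cases hij : i = j
    · simp [hij]
    · rw [if_neg hij, if_neg hij]
      exact hchunk (i + 2 * j) _ (fun l' => ClOp.toffoli i j (ν + l')) (fun _ => rfl)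
        (fun _ => by rw [← ite_and]; rfl)

/-- Splitting the diagonal off a double sum over `range n × range n` in `𝔽₂`. -/
theorem sum_sum_split_diag (n : ℕ) (c : ℕ → ZMod 2) (hc : ∀ i, c i * c i = c i) (C : ℕ → ZMod 2) :
    (∑ i ∈ Finset.range n, ∑ j ∈ Finset.range n, c i * c j * C (i + 2 * j)) =
      (∑ i ∈ Finset.range n, c i * C (3 * i)) +
        ∑ i ∈ Finset.range n, ∑ j ∈ Finset.range n, if i = j then 0 else c i * c j * C (i + 2 * j) := by
  rw [← Finset.sum_add_distrib]
  refine Finset.sum_congr rfl fun i hi => ?_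
  have hsplit : ∀ j, c i * c j * C (i + 2 * j) = (if i = j then c i * c j * C (i + 2 * j) else 0) +
      (if i = j then 0 else c i * c j * C (i + 2 * j)) := fun j => by
    by_cases h : i = j <;> simp [h]
  rw [Finset.sum_congr rfl fun j _ => hsplit j, Finset.sum_add_distrib, Finset.sum_ite_eq, if_pos hi, hc,
    show i + 2 * i = 3 * i by ring]

/-- **The cube program computes the cube map of `𝔽₂[X]/(Φ_{3^{k+1}})` in power-basis
coordinates**, as an identity in `𝔽₂`. -/
theorem ite_cubeMap_eq (y : Fin ν → Bool) (l : Fin ν) :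
    (if cubeMap ν y l then (1 : ZMod 2) else 0) =
      cubeEquiv k (((cubeEquiv k).symm fun i => if y i then 1 else 0) ^ 3) l := by
  have hwi : ∀ i : Fin ν, RevSim.liftW (padInput y ν) i = y i := fun i => by
    rw [show (i : ℕ) = ((Fin.castAdd ν i : Fin (ν + ν)) : ℕ) from rfl, RevSim.liftW_val]
    exact Fin.append_left _ _ _
  have hwl : RevSim.liftW (padInput y ν) (ν + l) = false := by
    rw [show ν + (l : ℕ) = ((Fin.natAdd ν l : Fin (ν + ν)) : ℕ) from rfl, RevSim.liftW_val]
    exact Fin.append_right _ _ _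
  generalize hw : RevSim.liftW (padInput y ν) = w at hwi hwl
  -- program side
  have hprog : cubeMap ν y l = (cubeOpsA ν).foldr
      (fun op acc => (decide (op.target = ν + (l : ℕ)) && op.guard w) ^^ acc) false := by
    show clEval (cubeOpsA ν) (RevSim.liftW (padInput y ν)) (ν + l) = _
    rw [hw, clEval_xor ν (cubeOpsA ν) (fun op hop => controls_lt_of_mem_cubeOpsA hop)
      (fun op hop => le_target_of_mem_cubeOpsA hop) w w (fun _ _ => rfl) (ν + l), hwl, Bool.false_xor]
  rw [hprog, show (cubeOpsA ν).foldr (fun op acc => (decide (op.target = ν + (l : ℕ)) && op.guard w) ^^ acc) false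
      = ((cubeOpsA ν).map fun op => decide (op.target = ν + (l : ℕ)) && op.guard w).foldr xor false from
      List.foldr_map.symm, ite_foldr_xor, List.map_map]
  rw [show ((fun b : Bool => if b then (1 : ZMod 2) else 0) ∘ fun op : ClOp ℕ =>
      decide (op.target = ν + ↑l) && op.guard w) = fun op =>
      if (decide (op.target = ν + (l : ℕ)) && op.guard w) then (1 : ZMod 2) else 0 from rfl,
    cubeOpsA_parity k w l]
  -- field side
  rw [cubeEquiv_cube]
  have hrhs : (∑ i : Fin ν, ∑ j : Fin ν, (if y i then (1 : ZMod 2) else 0) * (if y j then 1 else 0) *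
      cubeEquiv k ((α) ^ ((i : ℕ) + 2 * (j : ℕ))) l) =
      ∑ i ∈ Finset.range ν, ∑ j ∈ Finset.range ν,
        (if w i then (1 : ZMod 2) else 0) * (if w j then 1 else 0) * cubeEquiv k ((α) ^ (i + 2 * j)) l := by
    rw [← Fin.sum_univ_eq_sum_range (fun i => ∑ j ∈ Finset.range ν,
      (if w i then (1 : ZMod 2) else 0) * (if w j then 1 else 0) * cubeEquiv k ((α) ^ (i + 2 * j)) l) ν]
    refine Finset.sum_congr rfl fun i _ => ?_
    rw [← Fin.sum_univ_eq_sum_range (fun j =>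
      (if w i then (1 : ZMod 2) else 0) * (if w j then 1 else 0) * cubeEquiv k ((α) ^ ((i : ℕ) + 2 * j)) l) ν]
    refine Finset.sum_congr rfl fun j _ => ?_
    rw [hwi i, hwi j]
  rw [hrhs, sum_sum_split_diag ν (fun i => if w i then (1 : ZMod 2) else 0) (fun i => by
    cases w i <;> simp) (fun m => cubeEquiv k ((α) ^ m) l)]

/-- **`cubeMap (2·3^k)` is the cube map of `𝔽₂[X]/(Φ_{3^{k+1}})` in power-basis coordinates**,
in exactly the Boolean dress of the route's `CubeGraphFlat`. -/
theorem cubeMap_eq_cube (y : Fin ν → Bool) :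
    cubeMap ν y = fun l => decide (cubeEquiv k (((cubeEquiv k).symm fun i => if y i then 1 else 0) ^ 3) l = 1) := by
  funext l
  have h := ite_cubeMap_eq k y l
  cases hb : cubeMap ν y l
  · rw [hb, if_neg Bool.false_ne_true] at h
    rw [← h]; decide
  · rw [hb, if_pos rfl] at h
    rw [← h]; decide

end Main

end Summit.QuantumAdvantage.QuantumAdvantage.Theorems.SymplecticPurity
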